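import Summits.RiemannHypothesis.RiemannHypothesis.Theorems.WeilGroundStateArchimedeanWindowSimpleEvenGapSound3
import Summits.RiemannHypothesis.RiemannHypothesis.Theorems.WeilGroundStateArchimedeanWindowSimpleEvenGapCheckNuA
import Summits.RiemannHypothesis.RiemannHypothesis.Theorems.WeilGroundStateArchimedeanWindowSimpleEvenGapCheckNuB
import Summits.RiemannHypothesis.RiemannHypothesis.Theorems.WeilGroundStateArchimedeanWindowSimpleEvenGapCheck0
import Summits.RiemannHypothesis.RiemannHypothesis.Theorems.WeilGroundStateArchimedeanWindowSimpleEvenGapCheck1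
import Summits.RiemannHypothesis.RiemannHypothesis.Theorems.WeilGroundStateArchimedeanWindowSimpleEvenTrial4
import Summits.RiemannHypothesis.RiemannHypothesis.Theses.WeilGroundState
import HarnessLib

/-!
# Route WeilGroundState, item `ArchimedeanWindowSimpleEven` (stmt-RiemannHypothesis-1529): the proof

**Theorem (`archimedeanWindowSimpleEven_proof`).** At the archimedean window `a = (log 2)/2` the bottom
`ε(a) = weilGroundEnergy a` of Weil's quadratic form `Q(g) = W(g ⋆ g̃)` on test functions supported in
`[-a, a]` is separated from the odd sector and from the even sector orthogonal to an explicit witness: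
with `φ = weilGapCert.phi` (a real even polynomial of degree `42`) and `δ = 1/20 − 3/200 = 7/200`, every
`L²`-normalised test function `g` on the window which is odd, or even with `∫ conj φ · g = 0`, has
`ε(a) + δ ≤ Re Q(g)`.

## Proof
* LOWER (`θ = 1/20`): the gap certificate `weilGapCert` passes its checker (`weilGapCert_checkG`: the
  cells and scalars of the tree's `weilCert`, `κ' ≥ 0`, the moment table in two halves and the two gap
  blocks, all evaluated by the kernel, `…GapCheck*.lean`), so by the soundness theorem
  (`WeilGapCert.gap_of_checkG`, `…GapSound3.lean`; the constraint holds for odd `g` and is `∫ conj φ · g`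
  for every `g`, this file) `(1/20) ∫|g|² ≤ Re Q(g)` for the `g` in question.
* UPPER: `ε((log 2)/2) ≤ 3/200` (`weilGroundEnergy_log_two_half_le`, `…Trial4.lean`: form-domain
  Rayleigh quotient of the bump `(1 − 9x²)⁺`).
Hence `ε + δ ≤ 3/200 + 7/200 = 1/20 ≤ Re Q(g)`.

Numerically (route-review numerics, reproduced in the design of the certificate): `ε ≈ 1.33·10⁻³`
(simple, even), odd bottom `≈ 7.31·10⁻²`, second even level `≈ 0.661`; the certified levels are
`θ = 0.05` (odd block and even block ⊥ φ) and `θ₀ = 0.015`.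

## References
* H. Yoshida, *On Hermitian forms attached to zeta functions*, Adv. Stud. Pure Math. 21 (1992), §6.
* A. Connes, C. Consani, *Spectral triples and ζ-cycles*, Enseign. Math. 69 (2023), §2.2–2.5.
* A. Connes, W. D. van Suijlekom, Comm. Math. Phys. 406 (2025), Thm. 6.1 (the hypothesis certified here
  at `a = (log 2)/2`).
-/

namespace Summit.RiemannHypothesis.RiemannHypothesis.Theorems.WeilGroundState

open Literature.NumberTheory.LFunctions

namespace WeilGapCert

open Complex Finset MeasureTheory Set Filter
open scoped Real ComplexConjugate BigOperators

variable {c : WeilGapCert}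

/-! ### The constraint: odd test functions, and even ones orthogonal to `φ` -/

/-- Even moments of an odd function vanish. [folklore] -/
theorem weilMoment_even_eq_zero_of_odd {g : ℝ → ℂ} (hodd : ∀ t, g (-t) = -g t) (a : ℝ) (i : ℕ) :
    weilMoment a g (2 * i) = 0 := by
  unfold weilMoment
  have h := integral_neg_eq_self (fun x : ℝ ↦ g x * ((((x / a) ^ (2 * i) : ℝ)) : ℂ)) volume
  have e : (fun x : ℝ ↦ g (-x) * ((((-x / a) ^ (2 * i) : ℝ)) : ℂ)) =
      fun x ↦ -(g x * ((((x / a) ^ (2 * i) : ℝ)) : ℂ)) := by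
    funext x
    rw [hodd, show (-x / a) ^ (2 * i) = (x / a) ^ (2 * i) by rw [neg_div, Even.neg_pow ⟨i, two_mul i⟩]]
    ring
  simp only [e, integral_neg] at h
  linear_combination (-(1 : ℂ) / 2) * h

/-- The constraint holds for ODD test functions (all even moments vanish). [folklore] -/
theorem constraint_of_odd {g : ℝ → ℂ} (hodd : ∀ t, g (-t) = -g t) :
    ∑ j ∈ range c.base.nb,
      (getV c.cvec j : ℂ) * c.base.yVec (weilMoment (c.base.a0 : ℝ) g) 0 j = 0 := by
  refine Finset.sum_eq_zero fun j _ ↦ ?_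
  rw [WeilCert.yVec, Finset.sum_eq_zero fun i _ ↦ ?_, mul_zero]
  rw [add_zero, weilMoment_even_eq_zero_of_odd hodd, mul_zero]

/-- `∫ conj φ · g = Σ_j c_j y_j(g)` for a test function `g`: the pairing with the witness polynomial IS
the constraint functional. [folklore] -/
theorem integral_conj_phi_mul {g : ℝ → ℂ} (hg : IsWeilTest g) :
    ∫ t, conj (c.phi t) * g t =
      ∑ j ∈ range c.base.nb,
        (getV c.cvec j : ℂ) * c.base.yVec (weilMoment (c.base.a0 : ℝ) g) 0 j := by
  set a : ℝ := (c.base.a0 : ℝ) with ha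
  -- pointwise expansion of the integrand
  have hpt : ∀ t, conj (c.phi t) * g t =
      ∑ i ∈ range c.base.nb, (c.phiCoeff i : ℂ) * (g t * ((((t / a) ^ (2 * i) : ℝ)) : ℂ)) := by
    intro t
    rw [phi, Complex.conj_ofReal, ← ha]
    push_cast
    rw [Finset.sum_mul]
    refine Finset.sum_congr rfl fun i _ ↦ ?_
    ring
  simp_rw [hpt]
  have hint : ∀ i ∈ range c.base.nb,
      Integrable fun t ↦ (c.phiCoeff i : ℂ) * (g t * ((((t / a) ^ (2 * i) : ℝ)) : ℂ)) :=
    fun i _ ↦ (hg.integrable_mul (by fun_prop)).const_mul _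
  rw [integral_finsetSum _ hint]
  simp_rw [integral_const_mul]
  -- reorganise `Σ_i φ_i M_{2i} = Σ_j c_j Σ_i C_{ji} M_{2i}`
  have hφ : ∀ i, (c.phiCoeff i : ℂ) =
      ∑ j ∈ range c.base.nb, (getV c.cvec j : ℂ) * (getM (c.base.Cb 0) j i : ℂ) := by
    intro i
    rw [phiCoeff, sumR_eq_sum]
    push_cast
    rfl
  simp_rw [hφ, Finset.sum_mul]
  rw [Finset.sum_comm]
  refine Finset.sum_congr rfl fun j _ ↦ ?_
  rw [WeilCert.yVec, Finset.mul_sum]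
  refine Finset.sum_congr rfl fun i _ ↦ ?_
  rw [add_zero, weilMoment]
  ring

/-- **The gap bound in the item's language.** If `c.checkG = true`, then every test function `g` on
the window `[-(log 2)/2, (log 2)/2]` which is either odd, or orthogonal to the witness `φ`
(`∫ conj φ · g = 0`), satisfies `θ ∫ |g|² ≤ Re Q(g)`. [folklore] -/
theorem weilQuadratic_re_ge_of_checkG (h : c.checkG = true) {g : ℝ → ℂ} (hg : IsWeilTest g)
    (hsupp : tsupport g ⊆ Icc (-(Real.log 2 / 2)) (Real.log 2 / 2))
    (hpar : (∀ t, g (-t) = -g t) ∨ ∫ t, conj (c.phi t) * g t = 0) :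
    (c.theta : ℝ) * ∫ t, ‖g t‖ ^ 2 ≤ (weilQuadratic g).re := by
  rw [weilQuadratic_re_eq_weilArchQuadratic hg hsupp]
  have hcon : ∑ j ∈ range c.base.nb,
      (getV c.cvec j : ℂ) * c.base.yVec (weilMoment (c.base.a0 : ℝ) g) 0 j = 0 := by
    rcases hpar with hodd | horth
    · exact constraint_of_odd hodd
    · rw [← integral_conj_phi_mul hg, horth]
  exact gap_of_checkG h hg hsupp hcon

end WeilGapCert


/-! ## The gap checker passes on `weilGapCert` -/

/-- The cells of the minorant are those of the tree's `weilCert` (already checked by the kernel). [folklore] -/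
theorem checkCells_weilGapCert :
    checkCells weilGapCert.base.prec weilGapCert.base.wL weilGapCert.base.T weilGapCert.base.mwT
      weilGapCert.base.cells = true :=
  checkCells_weilCert

set_option maxHeartbeats 0 in
/-- **Kernel check** of the scalar side conditions with the moment table (`κ(nu) ≥ 0` included). [folklore] -/
theorem checkScalars_weilGapCert : weilGapCert.base.checkScalars weilGapCert.nu = true := by
  decide +kernel

set_option maxHeartbeats 0 in
/-- **Kernel check** `κ' = κ(nu) − θ − nuErr ≥ 0` (`κ' ≈ 1.6085`). [folklore] -/
theorem kappaG_nonneg_weilGapCert : decide (0 ≤ weilGapCert.kappaG) = true := by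
  decide +kernel

/-- **The gap certificate passes its checker.** [folklore] -/
theorem weilGapCert_checkG : weilGapCert.checkG = true := by
  unfold WeilGapCert.checkG
  rw [checkCells_weilGapCert, checkScalars_weilGapCert, kappaG_nonneg_weilGapCert,
    checkNuA_weilGapCert, checkNuB_weilGapCert, checkBlock0_weilGapCert, checkBlock1_weilGapCert]
  rfl

/-! ## The item -/

/-- **Item `ArchimedeanWindowSimpleEven` (stmt-RiemannHypothesis-1529) of route WeilGroundState.**
At `a = (log 2)/2`: with the witness `φ = weilGapCert.phi` and `δ = 7/200`, every `L²`-normalised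
test function `g` supported in `[-a, a]` that is odd, or even and orthogonal to `φ`, satisfies
`weilGroundEnergy a + δ ≤ Re (weilQuadratic g)`. Proof: `Re Q(g) ≥ 1/20` by the kernel-checked gap
certificate (`WeilGapCert.weilQuadratic_re_ge_of_checkG`, `weilGapCert_checkG`) and
`ε(a) ≤ 3/200` (`weilGroundEnergy_log_two_half_le`). -/
theorem archimedeanWindowSimpleEven_proof :
    Summit.RiemannHypothesis.RiemannHypothesis.Theses.WeilGroundState.ArchimedeanWindowSimpleEven := by
  unfold Summit.RiemannHypothesis.RiemannHypothesis.Theses.WeilGroundState.ArchimedeanWindowSimpleEven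
  refine ⟨weilGapCert.phi, 1 / 20 - 3 / 200, by norm_num, fun g hg hsupp hnorm hpar ↦ ?_⟩
  have hθ := WeilGapCert.weilQuadratic_re_ge_of_checkG weilGapCert_checkG hg hsupp
    (hpar.imp id And.right)
  rw [hnorm, mul_one, show weilGapCert.theta = 1 / 20 from rfl] at hθ
  have hε := weilGroundEnergy_log_two_half_le
  push_cast at hθ
  linarith

end Summit.RiemannHypothesis.RiemannHypothesis.Theorems.WeilGroundState
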